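import Summits.Ventures.PercRepro.RankLevelSetBoolInOutStrong

/-! # RankLevelSetBoolInOutShadow — KATONA'S INTERSECTING-SHADOW THEOREM FROM THE BOOLEAN (IO): FOR AN INTERSECTING
FAMILY `F` OF `k`-SETS OF `[n]` WITH `2k ≤ n`, `#F ≤ #(∂⁺^[n + 1 − 2k] F)` AND THE WHOLE NORMALIZED HALF RULE ON THE
ITERATED UPPER SHADOWS (night-1 g33; dossier §45.10 (b))

The levels of the up-closure of a `k`-uniform family `F` are its iterated upper shadows
(**`levelCount_upClosure_add`**: `#{W ⊇ some A ∈ F : #W = k + j} = #(∂⁺^[j] F)`), so the Boolean (IO) of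
`RankLevelSetBoolInOut` applied to the up-closure of an intersecting `F` reads: `#(∂⁺^[i] F) · C(n+1, k+j) ≤
#(∂⁺^[j] F) · C(n+1, k+i)` for `i < j`, `2k + i + j ≤ n + 1` (**`normSkew_upShadow_iterate_of_intersecting`**), and
at the reflection pair `(k, n + 1 − k)`: **`card_le_card_upShadow_iterate_of_intersecting`**:
`#F ≤ #(∂⁺^[n + 1 − 2k] F)` — by complementation (`𝒢 = Fᶜˢ`, `(n−k)`-uniform and `(n − 2k + 1)`-intersecting,
`∂⁺^[n+1−2k] F ↔ ∂^[n+1−2k] 𝒢` at level `k − 1`) this is Katona's 1964 theorem `|∂_{m−t} 𝒢| ≥ |𝒢|` for a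
`t`-intersecting `m`-uniform family, kernel-checked here via the cycle method. Every declaration has a docstring;
imports: the cell's own modules and Mathlib only. Axioms: standard. -/

namespace PercRepro

namespace Cycle

open Finset

variable {α : Type} [Fintype α] [DecidableEq α]

/-- **The levels of the up-closure of a `k`-uniform family are its iterated upper shadows.** -/
lemma levelCount_upClosure_add {F : Finset (Finset α)} {k : ℕ} (hF : Set.Sized k (F : Set (Finset α))) (j : ℕ) :
    levelCount (upClosure F) (k + j) = (Finset.upShadow^[j] F).card := by
  unfold levelCount
  congr 1
  ext W
  rw [Finset.mem_filter, mem_upClosure, Finset.mem_upShadow_iterate_iff_exists_mem_card_add]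
  constructor
  · rintro ⟨⟨A, hA, hAW⟩, hW⟩
    exact ⟨A, hA, hAW, by rw [hW, hF (Finset.mem_coe.mpr hA)]⟩
  · rintro ⟨A, hA, hAW, hW⟩
    exact ⟨⟨A, hA, hAW⟩, by rw [hW, hF (Finset.mem_coe.mpr hA)]⟩

/-- **The normalized half rule on the iterated upper shadows of an intersecting `k`-uniform family**: for
`i < j` with `2k + i + j ≤ n + 1`, `#(∂⁺^[i] F) · C(n+1, k+j) ≤ #(∂⁺^[j] F) · C(n+1, k+i)`. -/
theorem normSkew_upShadow_iterate_of_intersecting {n : ℕ} (hn : Fintype.card α = n) {F : Finset (Finset α)}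
    (hF : (F : Set (Finset α)).Intersecting) {k : ℕ} (hFk : Set.Sized k (F : Set (Finset α))) {i j : ℕ}
    (hij : i < j) (hR : 2 * k + i + j ≤ n + 1) :
    (Finset.upShadow^[i] F).card * (n + 1).choose (k + j) ≤
      (Finset.upShadow^[j] F).card * (n + 1).choose (k + i) := by
  have h := normSkew_levelCount_of_intersecting hn (intersecting_upClosure hF) (isUpperSet_upClosure F)
    (k + i) (k + j) (by omega) (by omega)
  rwa [levelCount_upClosure_add hFk i, levelCount_upClosure_add hFk j] at h

/-- **KATONA'S INTERSECTING-SHADOW THEOREM, upper form**: for an intersecting family `F` of `k`-subsets of a finite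
type with `n` elements and `2k ≤ n`, the `(n + 1 − k)`-sets containing a member of `F` are at least as many as the
members: `#F ≤ #(∂⁺^[n + 1 − 2k] F)`. -/
theorem card_le_card_upShadow_iterate_of_intersecting {n : ℕ} (hn : Fintype.card α = n)
    {F : Finset (Finset α)} (hF : (F : Set (Finset α)).Intersecting) {k : ℕ}
    (hFk : Set.Sized k (F : Set (Finset α))) (hk : 2 * k ≤ n) :
    F.card ≤ (Finset.upShadow^[n + 1 - 2 * k] F).card := by
  have h := normSkew_upShadow_iterate_of_intersecting hn hF hFk (i := 0) (j := n + 1 - 2 * k) (by omega)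
    (by omega)
  simp only [Function.iterate_zero, id_eq, Nat.add_zero] at h
  have hc : (n + 1).choose (k + (n + 1 - 2 * k)) = (n + 1).choose k := by
    rw [show k + (n + 1 - 2 * k) = n + 1 - k by omega, Nat.choose_symm (by omega)]
  rw [hc] at h
  exact Nat.le_of_mul_le_mul_right h (Nat.choose_pos (by omega))

end Cycle

end PercRepro
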